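/-
Copyright: the b2b-balaban T⁴-continuum CRUX team, row NE7b leaf lineage `t4-ne7b-formalise-leaf-03` (gen 156). Project licence.
-/
import Summits.QuantumFields.BalabanUV.T4Continuum.Spine.NE7b.SupBackgroundTorusLocalised
import Summits.QuantumFields.BalabanUV.T4Continuum.Spine.NE7b.SupTorusDirichletForm
import Summits.QuantumFields.BalabanUV.T4Continuum.Spine.NE7b.SupTorusEffectiveAction

/-!
# THE VARIATIONAL JUNCTION ON THE TORUS CARRIERS, INSTANCE: for the localised small-field background `σt` of the perturbed Gaussian
# skeleton on the torus `(ℤ∕(n+1)s)^d` (SBTL), the EFFECTIVE ACTION `wt ↦ S(σt wt)`, `S φ = ½Σ_x φ x·(A φ)(x) + Σ_x v(φ x)` (`v′ = u`,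
# `A = Δ^η + aQ′*Q′` read on the torus through PTC's carriers), IS DIFFERENTIABLE on the open torus ball `‖wt‖ < (N⁻¹ − c)r` WITH
# DERIVATIVE `k ↦ (n+1)^d·Σ_y λ(wt) y·k y`, `λ(wt) y = (n+1)^{−d} Σ_{p′ ∈ B n (windowMap y)} ((A(Ef σt wt))(p′) + u((Ef σt wt)(p′)))` — THE
# GRADIENT OF THE TORUS EFFECTIVE ACTION IS THE BLOCK VOLUME TIMES SISL's NEXT EQUATION MAP `Q′(A(σ w) + u∘(σ w))` READ ON THE TORUS;
# and `DS(σt wt)` kills the torus fibre `ker Q′t` (HSAH's fibre-criticality, discharged)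
# (row NE7b, node U5c; SBTL + TDF + TEA BY NAME; [folklore])

Cell `pub-balaban`, sub-cell `t4`, spine estimate NE7b (`T4WeightBudget.RelWeightBound`; the cell's OWN estimate — NOT PRINTED in
[Bałaban 1983–89], NOT PROVED).  Crux-route work under `Spine/NE7b/` by a row leaf (`t4-ne7b-formalise-leaf-03` gen 156) under
FREEZE (0)'s crux-prover clause, on the row OWNER's located item ([NE7bP1-G116-HANDOFF] NEXT (3)(iii): «the variational junction on
the torus … an instance needs the torus Dirichlet form on leaf-03's `Site` carriers»); NOTHING of Bałaban's is named as a Lean object,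
valued or asserted; no `T4Continuum/Support` leaf typed; no `def`, no notation (the action, the torus operators `Rf∘A∘Ef`,
`Rf∘Dσ∘Ec`, `Rc∘Q′∘Ef` and the coarse field `λ(wt)` are written out); zero `sorry`.  Imports (BY NAME): this lineage's SBTL
`…SupBackgroundTorusLocalised` (`exists_background_torus_localised`: the localised `σ` of (63), its torus background `σt wt = Rf(σ(Ec wt))`
with the sitewise equation on the closed torus ball and, on the open ball, the response `HasFDerivAt σ D (Ec wt)` with
`Rc(Q′(Ef(Dt vt))) = vt`, `Dt := Rf∘D∘Ec` (SLT)), TDF `…SupTorusDirichletForm` (`torus_operator_form_symm`, `sum_blockLift_mul_eq_blockAvg`,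
`apply_windowMap_of_blockConst`), TEA `…SupTorusEffectiveAction` (`hasFDerivAt_effectiveAction`, `fderiv_effectiveAction_apply`,
`fderiv_action_eq_zero_of_pairing`, `exists_clm_pair`); through them PTC's carriers (`periodise_periodic`, `natCast_mul_smul_eq`) and
the OWNER's (72) `sum_AX_periodic`.

WHY (located).  TEA types the junction GENERICALLY (finite carriers, letters in ∕ out): symmetric `At`, a `C¹` branch `σt` with response
`Dt`, a block mean `Qt` with `Qt∘Dt = 1`, and THE SITEWISE EQUATION IN PAIRING FORM.  This file DISCHARGES those letters on the
`Beta.Site` carriers: `At := Rf∘A∘Ef` is symmetric by TDF §3; `σt` is `C¹` through the carriers (§1: chain rule on `Rf ∘ σ ∘ Ec` from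
SBTL's `HasFDerivAt σ D (Ec wt)`); the field equation `A(Ef φ) + u∘(Ef φ)` of a torus field is periodic ((72) `sum_AX_periodic`) so SBTL's
sitewise equation reads ON THE TORUS as «`Atφ + u∘φ` is the block lift of its coarse block means `λ`» (TDF `apply_windowMap_of_blockConst`)
and pairs as `(n+1)^d·Σ_y λ y·(Rc(Q′(Ef h))) y` (TDF `sum_blockLift_mul_eq_blockAvg`); `Qt∘Dt = 1` is SBTL's torus block-mean clause.
One `obtain` on SBTL then gives the instance on the open torus ball.

WHAT IS PROVED ([folklore]; `ℓ^∞ := lp (fun _ : X d => ℝ) ∞`; coarse torus `Site d s`, `[NeZero s]`, fine torus `Site d ((n+1)*s)`;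
operators and carriers by their DISPLAYED actions):
* §1 **`hasFDerivAt_torus_background`**: `σt wt = Rf (σ (Ec wt))` for all `wt` and `HasFDerivAt σ D (Ec wt)` ⟹
  `HasFDerivAt σt ((Rf.comp D).comp Ec) wt` — SBTL's torus background is `C¹` on the open torus ball with SLT's `Dt` as derivative.
* §2 `fieldEq_periodic` (the field equation of a periodised torus field is `side•(s•t)`-periodic), **`fieldEq_torus_apply`** (under the
  sitewise equation: `(Rf(A(Ef φ))) x + u(φ x) = λ(bt x)`), **`pairing_of_sitewise`** (TEA's pairing letter with `vol = (n+1)^d`,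
  `c = λ`, `Qt = Rc∘Q′∘Ef`), `fderiv_action_torus_eq_zero` (`DS(φ)` kills the torus fibre: `Rc(Q′(Ef h)) = 0 ⟹ DS(φ) h = 0`).
* §3 **`hasFDerivAt_effectiveAction_torus_of_letters`** (ANY `σ ∕ σt ∕ D` with §1's letters, the sitewise equation at `σt wt` and
  `Rc(Q′(Ef(Dt k))) = k` ⟹ `HasFDerivAt (S∘σt) ((n+1)^d • ⟨λ(wt), –⟩) wt`), `fderiv_effectiveAction_torus_apply`.
* §4 **`exists_effectiveAction_torus`** (`d ≥ 3`; SBTL's binders VERBATIM plus a primitive `v` of `u`; every coarse period `s ≥ 1`):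
  SBTL's `Q′ ∕ A ∕ σ`, the four carrier maps and `σt` RE-EXPORTED with their actions and the torus letters needed to read the claim,
  AND on the open torus ball `‖wt‖ < (N⁻¹ − c)r`: `HasFDerivAt (S∘σt) ((n+1)^d • Lc) wt` for every covector `Lc` with the action
  `k ↦ Σ_y λ(wt) y·k y`, the `fderiv` reading, and fibre-criticality of `DS(σt wt)`.
* §5 toy.

HONEST (what this is NOT).  The GRADIENT row of the OWNER's (3)(iii) on the torus carriers; the HESSIAN row (TEA §4 fed with (63)'s
linearised fibre equation `P((A + N′(σ))Dσ k) = 0` read on the torus ⟹ `(S∘σt)″ = (n+1)^d·⟨Rc Q′(A + N′)Dσ Ec k, k′⟩`, (65)'s operator)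
is NOT in this file (successor); no minimality ∕ convexity of `S` on the fibre is claimed (criticality only — the minimiser
identification is leaf-03's CMR ∕ CVH road, convex case); constants (63)'s (existential, useless by value at small sides); cubic periods;
scalar skeleton, not the covariant operators ((A3), NC-NE7b-α UNRULED); nothing of Bałaban's.  BY-NAME EFFECT ON THE WALL: NONE.  NE7b
NOT PRINTED ∕ NOT PROVED; spine PROVED 0∕9; rung (B)+1 on a FINITE torus — NOT infinite volume, NOT the mass gap, NOT Clay.  HONEST
DEPENDENCY: continuum YM on T⁴ ⇐ BetaPertH ∧ nine spine estimates (0∕9 proved); BetaPertH ⇐ (D1) ∧ (D4) ∧ CAP+tail; G-an2-4 gates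
asym, D1 and NE2∕3∕4.
-/

set_option autoImplicit false

noncomputable section

namespace Summit.QuantumFields.BalabanUV.T4Continuum.NE7b.SupTorusEffectiveActionInstance

open Set Metric Function
open scoped ENNReal NNReal Topology
open Literature.MathematicalPhysics.QuantumFieldTheory.Balaban1983to89
open B4Sect5Proof (latticeConst latticeConst_nonneg)
open B6QGQLower276 (X blk B side AX)
open B6QGQDecay237 (deltaU)
open B5Hk103ScalarZd (nbhd deltaH)
open Summit.QuantumFields.BalabanUV.Beta.D1BFx.BlockColumnSupNorm (cHs)
open Summit.QuantumFields.BalabanUV.Beta.D1BFx.PointColumnSplit (cKL cG0 cSplit)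
open Summit.QuantumFields.BalabanUV.Beta.D1BFx.PointColumnDecay (cFar)
open Beta (Site siteOf windowMap siteOf_windowMap)
open AugmentedInversePeriodic (sum_AX_periodic)
open PeriodicSupTorusCarrier (periodise_periodic natCast_mul_smul_eq)
open SupTorusDirichletForm (torus_operator_form_symm sum_blockLift_mul_eq_blockAvg apply_windowMap_of_blockConst)
open SupTorusEffectiveAction (hasFDerivAt_effectiveAction fderiv_action_eq_zero_of_pairing exists_clm_pair)
open SupBackgroundTorusLocalised (exists_background_torus_localised)

variable {d : ℕ}

section Letters

variable (n : ℕ) (a : ℝ) (s : ℕ) [NeZero s]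
  {Dop Aop : lp (fun _ : X d => ℝ) ∞ →L[ℝ] lp (fun _ : X d => ℝ) ∞}
  (hD : ∀ (f : lp (fun _ : X d => ℝ) ∞) (y : X d), Dop f y = (((n : ℝ) + 1) ^ d)⁻¹ * ∑ p ∈ B n y, f p)
  (hA : ∀ (f : lp (fun _ : X d => ℝ) ∞) (p : X d), Aop f p = ∑ r ∈ nbhd n p, AX n a p r * f r)
  {Ef : (Site d ((n + 1) * s) → ℝ) →L[ℝ] lp (fun _ : X d => ℝ) ∞}
  (hEf : ∀ (g : Site d ((n + 1) * s) → ℝ) (q : X d), Ef g q = g (siteOf d ((n + 1) * s) q))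
  {Rf : lp (fun _ : X d => ℝ) ∞ →L[ℝ] (Site d ((n + 1) * s) → ℝ)}
  (hRf : ∀ (h : lp (fun _ : X d => ℝ) ∞) (x : Site d ((n + 1) * s)), Rf h x = h (windowMap d ((n + 1) * s) x))
  {Ec : (Site d s → ℝ) →L[ℝ] lp (fun _ : X d => ℝ) ∞}
  {Rc : lp (fun _ : X d => ℝ) ∞ →L[ℝ] (Site d s → ℝ)}
  (hRc : ∀ (h : lp (fun _ : X d => ℝ) ∞) (x : Site d s), Rc h x = h (windowMap d s x))

/-! ## §1. The torus background is `C¹` through the carriers -/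

/-- **THE TORUS BACKGROUND IS `C¹` WITH SLT's `Dt` AS DERIVATIVE**: if `σt wt = Rf (σ (Ec wt))` for every `wt` and `σ` has derivative
`D` at `Ec wt`, then `σt` has derivative `Rf ∘ D ∘ Ec` at `wt` (chain rule through the linear carrier maps). [folklore] -/
theorem hasFDerivAt_torus_background {σ : lp (fun _ : X d => ℝ) ∞ → lp (fun _ : X d => ℝ) ∞}
    {σt : (Site d s → ℝ) → (Site d ((n + 1) * s) → ℝ)} (hσt : ∀ wt, σt wt = Rf (σ (Ec wt))) {wt : Site d s → ℝ}
    {D : lp (fun _ : X d => ℝ) ∞ →L[ℝ] lp (fun _ : X d => ℝ) ∞} (hDσ : HasFDerivAt σ D (Ec wt)) :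
    HasFDerivAt σt ((Rf.comp D).comp Ec) wt := by
  have hfun : σt = fun wt => Rf (σ (Ec wt)) := funext hσt
  rw [hfun]
  exact Rf.hasFDerivAt.comp wt (hDσ.comp wt Ec.hasFDerivAt)

/-! ## §2. The field equation of a torus field: periodic, block lift of its block means under the sitewise equation, pairing -/

include hA hEf in
omit [NeZero s] in
/-- The field equation `A(Ef φ) + u∘(Ef φ)` of a periodised torus field is `side•(s•t)`-periodic ((72) `sum_AX_periodic`). [folklore] -/
theorem fieldEq_periodic (φ : Site d ((n + 1) * s) → ℝ) (u : ℝ → ℝ) (q t : X d) :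
    Aop (Ef φ) (q + side n • ((s : ℤ) • t)) + u (Ef φ (q + side n • ((s : ℤ) • t))) = Aop (Ef φ) q + u (Ef φ q) := by
  have hper : ∀ q t : X d, (Ef φ : X d → ℝ) (q + side n • ((s : ℤ) • t)) = Ef φ q := fun q t => by
    rw [← natCast_mul_smul_eq]
    exact periodise_periodic hEf φ q t
  rw [hA, hA, sum_AX_periodic n a s hper, hper]

include hA hEf hRf in
/-- **THE SITEWISE EQUATION READ ON THE TORUS**: if `A(Ef φ) + u∘(Ef φ)` equals its own block average at every lattice site, then at
every fine torus site `(Rf(A(Ef φ))) x + u(φ x) = λ(bt x)` with `λ y = (n+1)^{−d} Σ_{p′ ∈ B n (windowMap y)} ((A(Ef φ))(p′) + u((Ef φ)(p′)))`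
and `bt x = siteOf (blk n (windowMap x))` the torus block map. [folklore] -/
theorem fieldEq_torus_apply (φ : Site d ((n + 1) * s) → ℝ) (u : ℝ → ℝ)
    (heq : ∀ p : X d, Aop (Ef φ) p + u (Ef φ p)
      = (((n : ℝ) + 1) ^ d)⁻¹ * ∑ p' ∈ B n (blk n p), (Aop (Ef φ) p' + u (Ef φ p')))
    (x : Site d ((n + 1) * s)) :
    ((Rf.comp Aop).comp Ef) φ x + u (φ x)
      = (((n : ℝ) + 1) ^ d)⁻¹ * ∑ p' ∈ B n (windowMap d s (siteOf d s (blk n (windowMap d ((n + 1) * s) x)))),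
          (Aop (Ef φ) p' + u (Ef φ p')) := by
  have h1 : ((Rf.comp Aop).comp Ef) φ x = Aop (Ef φ) (windowMap d ((n + 1) * s) x) := by
    rw [ContinuousLinearMap.comp_apply, ContinuousLinearMap.comp_apply, hRf]
  have h2 : φ x = Ef φ (windowMap d ((n + 1) * s) x) := by rw [hEf, siteOf_windowMap]
  rw [h1, h2]
  exact apply_windowMap_of_blockConst n s (F := fun p => Aop (Ef φ) p + u (Ef φ p))
    (fieldEq_periodic n a s hA hEf φ u) heq x

include hD hA hEf hRf hRc in
/-- **THE SITEWISE EQUATION IN PAIRING FORM ON THE TORUS** (TEA's `hpair` with `vol = (n+1)^d`, `c = λ`, `Qt = Rc∘Q′∘Ef`): under the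
sitewise equation, `Σ_x ((Rf(A(Ef φ))) x + u(φ x))·h x = (n+1)^d·Σ_y λ y·(Rc(Q′(Ef h))) y` for every torus field `h`. [folklore] -/
theorem pairing_of_sitewise (φ : Site d ((n + 1) * s) → ℝ) (u : ℝ → ℝ)
    (heq : ∀ p : X d, Aop (Ef φ) p + u (Ef φ p)
      = (((n : ℝ) + 1) ^ d)⁻¹ * ∑ p' ∈ B n (blk n p), (Aop (Ef φ) p' + u (Ef φ p')))
    (h : Site d ((n + 1) * s) → ℝ) :
    ∑ x, (((Rf.comp Aop).comp Ef) φ x + u (φ x)) * h x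
      = ((n : ℝ) + 1) ^ d * ∑ y : Site d s,
          ((((n : ℝ) + 1) ^ d)⁻¹ * ∑ p' ∈ B n (windowMap d s y), (Aop (Ef φ) p' + u (Ef φ p')))
            * ((Rc.comp Dop).comp Ef) h y := by
  simp only [fieldEq_torus_apply n a s hA hEf hRf φ u heq]
  exact sum_blockLift_mul_eq_blockAvg n s hD hEf hRc
    (fun y => (((n : ℝ) + 1) ^ d)⁻¹ * ∑ p' ∈ B n (windowMap d s y), (Aop (Ef φ) p' + u (Ef φ p'))) h

include hD hA hEf hRf hRc in
/-- **`DS(φ)` KILLS THE TORUS FIBRE** (HSAH's fibre-criticality, discharged): under the sitewise equation at `φ`, for every torus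
field `h` with vanishing torus block means (`Rc(Q′(Ef h)) = 0`), `fderiv S φ h = 0`. [folklore] -/
theorem fderiv_action_torus_eq_zero {v u : ℝ → ℝ} (hv : ∀ t, HasDerivAt v (u t) t) (φ : Site d ((n + 1) * s) → ℝ)
    (heq : ∀ p : X d, Aop (Ef φ) p + u (Ef φ p)
      = (((n : ℝ) + 1) ^ d)⁻¹ * ∑ p' ∈ B n (blk n p), (Aop (Ef φ) p' + u (Ef φ p')))
    (h : Site d ((n + 1) * s) → ℝ) (hh : ((Rc.comp Dop).comp Ef) h = 0) :
    fderiv ℝ (fun φ : Site d ((n + 1) * s) → ℝ =>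
        (1 / 2 : ℝ) * ∑ x, φ x * ((Rf.comp Aop).comp Ef) φ x + ∑ x, v (φ x)) φ h = 0 :=
  fderiv_action_eq_zero_of_pairing ((Rf.comp Aop).comp Ef) (torus_operator_form_symm n a s hA hEf hRf) hv
    ((Rc.comp Dop).comp Ef) (pairing_of_sitewise n a s hD hA hEf hRf hRc φ u heq) h hh

/-! ## §3. The gradient of the torus effective action, letters form -/

include hD hA hEf hRf hRc in
/-- **THE GRADIENT OF THE TORUS EFFECTIVE ACTION IS THE BLOCK VOLUME TIMES THE NEXT EQUATION MAP** (letters form): for ANY background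
`σ` with torus background `σt wt = Rf(σ(Ec wt))`, response `D` at `Ec wt` (`HasFDerivAt σ D (Ec wt)`), torus block means of the torus
response equal to the datum (`Rc(Q′(Ef(Dt k))) = k`, `Dt = Rf∘D∘Ec`), and the sitewise equation at `σt wt`:
`HasFDerivAt (S∘σt) ((n+1)^d • Lc) wt` for every covector `Lc` with the action `k ↦ Σ_y λ(wt) y·k y`. [folklore] -/
theorem hasFDerivAt_effectiveAction_torus_of_letters {v u : ℝ → ℝ} (hv : ∀ t, HasDerivAt v (u t) t)
    {σ : lp (fun _ : X d => ℝ) ∞ → lp (fun _ : X d => ℝ) ∞} {σt : (Site d s → ℝ) → (Site d ((n + 1) * s) → ℝ)}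
    (hσt : ∀ wt, σt wt = Rf (σ (Ec wt))) {wt : Site d s → ℝ} {D : lp (fun _ : X d => ℝ) ∞ →L[ℝ] lp (fun _ : X d => ℝ) ∞}
    (hDσ : HasFDerivAt σ D (Ec wt)) (hsec : ∀ k : Site d s → ℝ, Rc (Dop (Ef (((Rf.comp D).comp Ec) k))) = k)
    (heq : ∀ p : X d, Aop (Ef (σt wt)) p + u (Ef (σt wt) p)
      = (((n : ℝ) + 1) ^ d)⁻¹ * ∑ p' ∈ B n (blk n p), (Aop (Ef (σt wt)) p' + u (Ef (σt wt) p')))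
    {Lc : (Site d s → ℝ) →L[ℝ] ℝ}
    (hLc : ∀ k : Site d s → ℝ, Lc k = ∑ y : Site d s,
      ((((n : ℝ) + 1) ^ d)⁻¹ * ∑ p' ∈ B n (windowMap d s y), (Aop (Ef (σt wt)) p' + u (Ef (σt wt) p'))) * k y) :
    HasFDerivAt (fun w : Site d s → ℝ =>
        (1 / 2 : ℝ) * ∑ x, σt w x * ((Rf.comp Aop).comp Ef) (σt w) x + ∑ x, v (σt w x))
      ((((n : ℝ) + 1) ^ d) • Lc) wt :=
  hasFDerivAt_effectiveAction ((Rf.comp Aop).comp Ef) (torus_operator_form_symm n a s hA hEf hRf) hv σt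
    (hasFDerivAt_torus_background n s hσt hDσ) ((Rc.comp Dop).comp Ef)
    (fun k => hsec k)
    (pairing_of_sitewise n a s hD hA hEf hRf hRc (σt wt) u heq) hLc

include hD hA hEf hRf hRc in
/-- `fderiv` form: `D(S∘σt)(wt) k = (n+1)^d·Σ_y λ(wt) y·k y`. [folklore] -/
theorem fderiv_effectiveAction_torus_apply {v u : ℝ → ℝ} (hv : ∀ t, HasDerivAt v (u t) t)
    {σ : lp (fun _ : X d => ℝ) ∞ → lp (fun _ : X d => ℝ) ∞} {σt : (Site d s → ℝ) → (Site d ((n + 1) * s) → ℝ)}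
    (hσt : ∀ wt, σt wt = Rf (σ (Ec wt))) {wt : Site d s → ℝ} {D : lp (fun _ : X d => ℝ) ∞ →L[ℝ] lp (fun _ : X d => ℝ) ∞}
    (hDσ : HasFDerivAt σ D (Ec wt)) (hsec : ∀ k : Site d s → ℝ, Rc (Dop (Ef (((Rf.comp D).comp Ec) k))) = k)
    (heq : ∀ p : X d, Aop (Ef (σt wt)) p + u (Ef (σt wt) p)
      = (((n : ℝ) + 1) ^ d)⁻¹ * ∑ p' ∈ B n (blk n p), (Aop (Ef (σt wt)) p' + u (Ef (σt wt) p')))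
    (k : Site d s → ℝ) :
    fderiv ℝ (fun w : Site d s → ℝ =>
        (1 / 2 : ℝ) * ∑ x, σt w x * ((Rf.comp Aop).comp Ef) (σt w) x + ∑ x, v (σt w x)) wt k
      = ((n : ℝ) + 1) ^ d * ∑ y : Site d s,
          ((((n : ℝ) + 1) ^ d)⁻¹ * ∑ p' ∈ B n (windowMap d s y), (Aop (Ef (σt wt)) p' + u (Ef (σt wt) p'))) * k y := by
  obtain ⟨Lc, hLc⟩ := exists_clm_pair (ι := Site d s)
    (fun y => (((n : ℝ) + 1) ^ d)⁻¹ * ∑ p' ∈ B n (windowMap d s y), (Aop (Ef (σt wt)) p' + u (Ef (σt wt) p')))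
  rw [(hasFDerivAt_effectiveAction_torus_of_letters n a s hD hA hEf hRf hRc hv hσt hDσ hsec heq hLc).fderiv, smul_apply, hLc,
    smul_eq_mul]

end Letters

/-! ## §4. The instance on SBTL's localised small-field background -/

/-- **THE GRADIENT OF THE TORUS EFFECTIVE ACTION AT THE SMALL-FIELD BACKGROUND** (`d ≥ 3`; SBTL's binders VERBATIM — (63)'s — plus a
primitive `v` of the sitewise term `u`; every coarse period `s ≥ 1`).  SBTL's `Q′ ∕ A ∕ σ`, carrier maps and torus background `σt`
re-exported with the actions and letters needed to read the claim, AND on the open torus ball `‖wt‖ < (N⁻¹ − c)r`: the effective action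
`wt ↦ ½Σ_x (σt wt) x·(Rf(A(Ef(σt wt)))) x + Σ_x v((σt wt) x)` has derivative `(n+1)^d • Lc` for every covector `Lc` with the action
`k ↦ Σ_y λ(wt) y·k y`, `λ(wt)` the coarse block means of the field equation `A(Ef σt wt) + u∘(Ef σt wt)` (SISL's next equation map read on
the torus); the `fderiv` reading; and `DS(σt wt)` kills the torus fibre `ker(Rc∘Q′∘Ef)`. [folklore] -/
theorem exists_effectiveAction_torus (hd : 3 ≤ d) (n : ℕ) {a : ℝ} (ha : 0 < a)
    {v u u' : ℝ → ℝ} (hv : ∀ t, HasDerivAt v (u t) t) (hu : ∀ t, HasDerivAt u (u' t) t) (hu0 : u 0 = 0) {lam c N : ℝ≥0}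
    (hlam : ∀ t, |u' t| ≤ lam) {L : ℝ} (hL0 : 0 ≤ L) (hL : ∀ s t, |u' s - u' t| ≤ L * |s - t|)
    (hN : cHs d a * latticeConst d (deltaH d a)
        + ((cG0 d * cKL d (d - 2) + cSplit d a) * Real.exp (2 * deltaU d a)
            + cFar d a * Real.exp (4 * deltaU d a) / deltaU d a ^ 2) * latticeConst d (deltaU d a / 4)
          * (1 + cHs d a * latticeConst d (deltaH d a)) ≤ (N : ℝ))
    (hc : 2 * lam ≤ c) (hcN : c < N⁻¹) {r : ℝ} (hr : 0 ≤ r) (s : ℕ) [NeZero s] :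
    ∃ (Dop Aop : lp (fun _ : X d => ℝ) ∞ →L[ℝ] lp (fun _ : X d => ℝ) ∞)
      (σ : lp (fun _ : X d => ℝ) ∞ → lp (fun _ : X d => ℝ) ∞)
      (Ef : (Site d ((n + 1) * s) → ℝ) →L[ℝ] lp (fun _ : X d => ℝ) ∞)
      (Rf : lp (fun _ : X d => ℝ) ∞ →L[ℝ] (Site d ((n + 1) * s) → ℝ))
      (Ec : (Site d s → ℝ) →L[ℝ] lp (fun _ : X d => ℝ) ∞)
      (Rc : lp (fun _ : X d => ℝ) ∞ →L[ℝ] (Site d s → ℝ))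
      (σt : (Site d s → ℝ) → (Site d ((n + 1) * s) → ℝ)),
      (∀ (f : lp (fun _ : X d => ℝ) ∞) (y : X d), Dop f y = (((n : ℝ) + 1) ^ d)⁻¹ * ∑ p ∈ B n y, f p) ∧
      (∀ (f : lp (fun _ : X d => ℝ) ∞) (p : X d), Aop f p = ∑ r ∈ nbhd n p, AX n a p r * f r) ∧
      (∀ (g : Site d ((n + 1) * s) → ℝ) (q : X d), Ef g q = g (siteOf d ((n + 1) * s) q)) ∧
      (∀ (h : lp (fun _ : X d => ℝ) ∞) (x : Site d ((n + 1) * s)), Rf h x = h (windowMap d ((n + 1) * s) x)) ∧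
      (∀ (g : Site d s → ℝ) (q : X d), Ec g q = g (siteOf d s q)) ∧
      (∀ (h : lp (fun _ : X d => ℝ) ∞) (x : Site d s), Rc h x = h (windowMap d s x)) ∧
      (∀ wt, σt wt = Rf (σ (Ec wt))) ∧ σt 0 = 0 ∧
      (∀ wt ∈ closedBall (0 : Site d s → ℝ) (((N : ℝ)⁻¹ - c) * r),
        σt wt ∈ closedBall 0 r ∧ Ef (σt wt) = σ (Ec wt) ∧ Rc (Dop (Ef (σt wt))) = wt ∧
          ∀ p : X d, Aop (Ef (σt wt)) p + u (Ef (σt wt) p)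
            = (((n : ℝ) + 1) ^ d)⁻¹ * ∑ p' ∈ B n (blk n p), (Aop (Ef (σt wt)) p' + u (Ef (σt wt) p'))) ∧
      -- THE GRADIENT OF THE TORUS EFFECTIVE ACTION on the open torus ball
      ∀ wt ∈ ball (0 : Site d s → ℝ) (((N : ℝ)⁻¹ - c) * r),
        (∃ D : lp (fun _ : X d => ℝ) ∞ →L[ℝ] lp (fun _ : X d => ℝ) ∞,
          HasFDerivAt σ D (Ec wt) ∧ ‖D‖ ≤ ((N : ℝ)⁻¹ - c)⁻¹ ∧ HasFDerivAt σt ((Rf.comp D).comp Ec) wt ∧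
            ∀ vt, Rc (Dop (Ef (((Rf.comp D).comp Ec) vt))) = vt) ∧
        (∀ Lc : (Site d s → ℝ) →L[ℝ] ℝ,
          (∀ k : Site d s → ℝ, Lc k = ∑ y : Site d s,
            ((((n : ℝ) + 1) ^ d)⁻¹ * ∑ p' ∈ B n (windowMap d s y), (Aop (Ef (σt wt)) p' + u (Ef (σt wt) p'))) * k y) →
          HasFDerivAt (fun w : Site d s → ℝ =>
              (1 / 2 : ℝ) * ∑ x, σt w x * ((Rf.comp Aop).comp Ef) (σt w) x + ∑ x, v (σt w x))
            ((((n : ℝ) + 1) ^ d) • Lc) wt) ∧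
        (∀ k : Site d s → ℝ,
          fderiv ℝ (fun w : Site d s → ℝ =>
              (1 / 2 : ℝ) * ∑ x, σt w x * ((Rf.comp Aop).comp Ef) (σt w) x + ∑ x, v (σt w x)) wt k
            = ((n : ℝ) + 1) ^ d * ∑ y : Site d s,
                ((((n : ℝ) + 1) ^ d)⁻¹ * ∑ p' ∈ B n (windowMap d s y), (Aop (Ef (σt wt)) p' + u (Ef (σt wt) p'))) * k y) ∧
        (∀ h : Site d ((n + 1) * s) → ℝ, Rc (Dop (Ef h)) = 0 →
          fderiv ℝ (fun φ : Site d ((n + 1) * s) → ℝ =>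
              (1 / 2 : ℝ) * ∑ x, φ x * ((Rf.comp Aop).comp Ef) φ x + ∑ x, v (φ x)) (σt wt) h = 0) := by
  obtain ⟨Dop, Aop, Pop, N', σ, Cf, Ef, Rf, Ec, Rc, σt, hD, hA, -, -, -, -, -, -, -, hEf, hRf, hEc, hRc, -, -, -, -, hσt, hσt0,
    hball, -, -, htorus⟩ := exists_background_torus_localised hd n ha hu hu0 hlam hL0 hL hN hc hcN hr s
  refine ⟨Dop, Aop, σ, Ef, Rf, Ec, Rc, σt, hD, hA, hEf, hRf, hEc, hRc, hσt, hσt0,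
    fun wt hwt => ⟨(hball wt hwt).1, (hball wt hwt).2.1, (hball wt hwt).2.2.2.1, (hball wt hwt).2.2.2.2⟩, fun wt hwt => ?_⟩
  obtain ⟨⟨D, hDσ, hDn, -, -, hsec⟩, -, -, -⟩ := htorus wt hwt
  have heq := (hball wt (ball_subset_closedBall hwt)).2.2.2.2
  refine ⟨⟨D, hDσ, hDn, hasFDerivAt_torus_background n s hσt hDσ, hsec⟩,
    fun Lc hLc => hasFDerivAt_effectiveAction_torus_of_letters n a s hD hA hEf hRf hRc hv hσt hDσ hsec heq hLc,
    fun k => fderiv_effectiveAction_torus_apply n a s hD hA hEf hRf hRc hv hσt hDσ hsec heq k,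
    fun h hh => fderiv_action_torus_eq_zero n a s hD hA hEf hRf hRc hv (σt wt) heq h hh⟩

/-! ## §5. Toy -/

/-- Toy: a map that is `Rf ∘ σ ∘ Ec` with `σ` a continuous linear map has derivative `Rf ∘ σ ∘ Ec` everywhere (§1 at `D := σ`). -/
example (n s : ℕ) [NeZero s] {Rf : lp (fun _ : X d => ℝ) ∞ →L[ℝ] (Site d ((n + 1) * s) → ℝ)}
    {Ec : (Site d s → ℝ) →L[ℝ] lp (fun _ : X d => ℝ) ∞}
    (T : lp (fun _ : X d => ℝ) ∞ →L[ℝ] lp (fun _ : X d => ℝ) ∞) (wt : Site d s → ℝ) :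
    HasFDerivAt (fun w : Site d s → ℝ => Rf (T (Ec w))) ((Rf.comp T).comp Ec) wt :=
  hasFDerivAt_torus_background n s (σ := fun f => T f) (fun _ => rfl) T.hasFDerivAt

end Summit.QuantumFields.BalabanUV.T4Continuum.NE7b.SupTorusEffectiveActionInstance

end
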